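import Literature.AnabelianGeometry.SemiGraphs.TemperedReconstructionBranchProofs
import HarnessLib

/-!
# Semi-graphs of anabelioids, §3: Corollary 3.9, step (b) — the morphism of underlying graphs
# determined by a quasi-geometric homomorphism (compatible reading of Def. 3.8)

Mochizuki, *Semi-graphs of anabelioids*, Publ. RIMS **42** (2006), §3, Cor. 3.9, proof, p. 42
[cite: MochizukiSemiAnbd2006, Cor 3.9 p.42]: a quasi-geometric `φ` "determines a map from the
vertices of `G` to the vertices of `H` … a map from the edges of `G` to the edges of `H` which is
compatible with the map obtained above on vertices" — i.e. a morphism of the underlying graphs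
(§1 p. 11).  Proof-only assembly of `existsUnique_vertexMap_of_isQuasiGeometric`,
`existsUnique_edgeMap_of_isQuasiGeometric` and `exists_branches_of_isQuasiGeometric`: under the
COMPATIBLE reading of Def. 3.8 (ii) (explicit hypothesis `hcompat`, cf. finding t2g2-F1) there is a
morphism of semi-graphs `F : G → H` whose vertex and edge maps are the maps `f_V`, `f_E` determined by
`φ` (`exists_semiGraphHom_of_isQuasiGeometric`).  What then remains of the residual R2
(`QuasiGeometricGraphData`) is the anabelioid-level datum over `F` (vertex/edge group homomorphisms
with open image and their 2-cells) — not treated here.  Nothing here takes a side on [IUTchIII]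
Cor. 3.12, nor on the reading of Def. 3.8 (the hypothesis is explicit).
-/

open CategoryTheory Topology

namespace Literature.AnabelianGeometry.SemiGraphs

namespace ProfiniteSemiGraph

universe u

variable {𝒢 ℋ : ProfiniteSemiGraph.{u}}

/-- **The morphism of underlying graphs of a quasi-geometric `φ`** ([SemiAnbd] Cor. 3.9, proof,
p. 42), under the compatible reading of Def. 3.8 (ii): a morphism of semi-graphs `G → H` with vertex
map `f_V` and edge map `f_E`. [cite: MochizukiSemiAnbd2006, Cor 3.9 p.42] -/
theorem exists_semiGraphHom_of_isQuasiGeometric (h37i : VerticialInjective.{u})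
    (h37iii : CompactInVerticial.{u}) (h37iv : MaximalCompactIffVerticial.{u})
    (h𝒢 : Cor39Hypotheses 𝒢) (hℋ : Cor39Hypotheses ℋ) (c𝒢 : TemperedPiChart 𝒢)
    (cℋ : TemperedPiChart ℋ) (φ : c𝒢.G →ₜ* cℋ.G)
    (hcompat : ∀ K₁ H₁ : Subgroup c𝒢.G, IsMaximalCompactSubgroup K₁ → IsMaximalCompactSubgroup H₁ →
      K₁ ≠ H₁ → K₁ ⊓ H₁ ≠ ⊥ → ∃ K₂ H₂ : Subgroup cℋ.G, IsMaximalCompactSubgroup K₂ ∧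
        IsMaximalCompactSubgroup H₂ ∧ K₂ ≠ H₂ ∧ K₁.map φ.toMonoidHom ≤ K₂ ∧ H₁.map φ.toMonoidHom ≤ H₂)
    {fV : 𝒢.graph.Vertex → ℋ.graph.Vertex} {fE : 𝒢.graph.Edge → ℋ.graph.Edge}
    (hfV : ∀ (v : 𝒢.graph.Vertex) (K : Subgroup c𝒢.G), K ∈ verticialSubgroups c𝒢 v →
      ∃ K₂ ∈ verticialSubgroups cℋ (fV v), MapsOntoOpenSubgroupOf φ.toMonoidHom K K₂)
    (hfE : ∀ (e : 𝒢.graph.Edge) (L : Subgroup c𝒢.G), L ∈ edgeLikeSubgroups c𝒢 e →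
      ∃ L₂ ∈ edgeLikeSubgroups cℋ (fE e), MapsOntoOpenSubgroupOf φ.toMonoidHom L L₂) :
    ∃ F : SemiGraph.Hom 𝒢.graph ℋ.graph, F.vertexMap = fV ∧ F.edgeMap = fE := by
  classical
  -- enumerate the two branches of every edge of `G`, and their vertices (`G` is a graph)
  choose β₁ β₂ hβ hβ₁ hβ₂ hβall using 𝒢.graph.two_branches
  have hvert : ∀ b : 𝒢.graph.Branch, ∃ v, 𝒢.graph.abuts b = some v := fun b =>
    Option.isSome_iff_exists.mp (h𝒢.isGraph.abuts_isSome b)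
  choose vOf hvOf using hvert
  -- matching target branches, edge by edge
  choose γ₁ γ₂ hγ hγ₁ hγ₂ hγv₁ hγv₂ using fun e : 𝒢.graph.Edge =>
    exists_branches_of_isQuasiGeometric h37i h37iii h37iv h𝒢 hℋ c𝒢 cℋ φ hcompat hfV hfE (hβ e)
      (hβ₁ e) (hβ₂ e) (hvOf (β₁ e)) (hvOf (β₂ e))
  have hvOf_eq : ∀ {b : 𝒢.graph.Branch} {v : 𝒢.graph.Vertex}, 𝒢.graph.abuts b = some v → vOf b = v :=
    fun {b v} h => Option.some_injective _ ((hvOf b).symm.trans h)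
  refine ⟨{ vertexMap := fV
            edgeMap := fE
            branchMap := fun b =>
              if b = β₁ (𝒢.graph.edgeOf b) then γ₁ (𝒢.graph.edgeOf b) else γ₂ (𝒢.graph.edgeOf b)
            edgeOf_branchMap := fun b => by
              split_ifs
              · exact hγ₁ _
              · exact hγ₂ _
            branchMap_injOn := fun b₁ b₂ he h => by
              generalize hE : 𝒢.graph.edgeOf b₂ = e at he h
              rw [he] at h
              rcases hβall e b₁ he with rfl | rfl <;> rcases hβall e b₂ hE with rfl | rfl
              · rfl
              · rw [if_pos rfl, if_neg (hβ e).symm] at h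
                exact absurd h (hγ e)
              · rw [if_neg (hβ e).symm, if_pos rfl] at h
                exact absurd h.symm (hγ e)
              · rfl
            abuts_branchMap := fun b v h => by
              split_ifs with hb
              · rw [hγv₁, ← hb, hvOf_eq h]
              · rcases hβall _ b rfl with h₁ | h₂
                · exact absurd h₁ hb
                · rw [hγv₂, ← h₂, hvOf_eq h] }, rfl, rfl⟩

end ProfiniteSemiGraph

end Literature.AnabelianGeometry.SemiGraphs
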